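import Summits.CriticalPhenomena.PercolationContinuityZ3.Theorems.Transplant.FKConnectivityAllQForestHubFourNode
import HarnessLib

/-!
# The 4-terminal node HUB⁺ (`HubFourPlusOn`, NOT asserted) and its kernel consequence: the square-free adjacent forest Rayleigh
# inequality WITH MARGIN `2E_vy` at every hub of degree 4

Support file (`--supports stmt-CriticalPhenomena-4575`), FK sub-lane `prim-bschramm-fk-1` (gen 24) of the post-continuity programme;
builds on p205010 (kernel theorem, internal audit signed; external expert review pending).  Two definitions (one counting predicate, one
`@[conjecture]` node — NOT asserted), no named facts, no sorries; standard axioms.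

THE NODE HUB⁺ (memo bschramm/FROM-fk-1-g24-HUB-EVENT-CALCULUS.md §2).  For a fibre `(N, u)` on the vertex type `V` and four distinct vertices
`v, y, a, b`, with all counts `#(P, Q) = fibreCount N u P Q` over configurations `ω` (first event) and partners `ω ∆ N` (second event):
`D := #(Fo ∩ {v,y,a,b pairwise separated}, Fo)`, `E_ab := #(Fo ∩ {a ~ b, the other five pairs separated}, Fo)`,
`M₁ := #(Fo ∩ {v ↮ y}, Fo ∩ {a ↮ b})`, `M₂ := #(Fo ∩ {v ↮ a}, Fo ∩ {y ↮ b})`, `M₃ := #(Fo ∩ {v ↮ b}, Fo ∩ {y ↮ a})` (the three perfect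
matchings of `{v,y,a,b}`, one pair separated in the configuration and the other in the partner).  **HUB⁺: `D + 2·E_ab + M₁ ≤ M₂ + M₃`.**
In words (uniform ordered 2-forest colourings `(A,B)` of a multigraph `H` with four marked vertices): the number of colourings with all four
`A`-separated, plus twice the number with `a ~_A b` the only `A`-join, plus the number with `v ≁_A y ∧ a ≁_B b`, is at most the number with
`v ≁_A a ∧ y ≁_B b` plus the number with `v ≁_A b ∧ y ≁_B a`.
* It is SHARPER than the lineage's node (♣)⁰ = `AdjForestRayleighNoSqOn` at a degree-4 hub: by `hubFour_margin_identity` (`…ForestHubFourNode`)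
  (♣)⁰ there reads `D + 2E_ab + M₁ ≤ 2E_vy + M₂ + M₃`, and HUB⁺ gives it with margin `good − bad ≥ 2E_vy`
  (**`adjForestNoSq_fibre_margin_of_hubFourPlusOn`** below); at a degree-3 hub `good − bad = 2E_vy` is an identity (`…ForestHubThree`).
* EVIDENCE (exact, exhaustive; memo §2): 0 failures over every connected simple rest with ≤ 8 vertices and every labelled quadruple
  (2,150,820 instances at n = 8; 129,216 at n ≤ 7), over 421,876 random multigraph rests on ≤ 6 vertices, and for the analogous statement
  `good − bad ≥ 2E_vy` at hub degrees 5, 6, 7 (5.0·10⁶ instances, n ≤ 8); in a 5-parameter family of candidate inequalities it is the only valid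
  point; it is tight on ≈ 70 % of instances.  It is FALSE pointwise (13 obstruction trace states = fk-1 g23's hub states) and full-star
  conditioning (each colour pattern of `oa, ob` separately) is false (n = 5), so any proof moves mass between backgrounds.
CONJECTURE-SHAPED COUNTING STATEMENT, NOT asserted: `HubFourPlusOn V`, `@[conjecture] HubFourPlusPos`.
[cite: SempleWelsh2008, Conj. 1.1 (p. 2); Thm. 4.2 (p. 11)] [cite: CibulkaHladkyLaCroixWagner2008, Thm. 1 (p. 2)] [cite: Linusson2011, Prop. 2.6]
-/

noncomputable section

namespace Summit.CriticalPhenomena.PercolationContinuityZ3.Theorems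
namespace FK

open MeasureTheory Set Literature.Probability.LatticeModels Literature.Probability.Percolation
open scoped Classical symmDiff

variable {V : Type*} [Fintype V]

/-- **HUB⁺ on the vertex type `V`**: for every fibre `(N, u)` and distinct `v, y, a, b`, `D + 2·E_ab + M₁ ≤ M₂ + M₃` (three-matchings form;
see the module docstring).  CONJECTURE-SHAPED, NOT asserted. [cite: SempleWelsh2008, Conj. 1.1 (p. 2)] [cite: Linusson2011, Prop. 2.6] -/
def HubFourPlusOn (V : Type*) [Fintype V] : Prop :=
  ∀ (N u : BondConfig V), Disjoint u N → ∀ (v y a b : V), v ≠ y → v ≠ a → v ≠ b → y ≠ a → y ≠ b → a ≠ b →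
    fibreCount N u
        (forestEv V ∩ {ω | ¬ (openGraph ω).Reachable v y ∧ ¬ (openGraph ω).Reachable v a ∧ ¬ (openGraph ω).Reachable v b ∧
          ¬ (openGraph ω).Reachable y a ∧ ¬ (openGraph ω).Reachable y b ∧ ¬ (openGraph ω).Reachable a b}) (forestEv V) +
      2 * fibreCount N u
        (forestEv V ∩ {ω | (openGraph ω).Reachable a b ∧ ¬ (openGraph ω).Reachable v y ∧ ¬ (openGraph ω).Reachable v a ∧
          ¬ (openGraph ω).Reachable v b ∧ ¬ (openGraph ω).Reachable y a ∧ ¬ (openGraph ω).Reachable y b}) (forestEv V) +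
      fibreCount N u (forestEv V ∩ {ω | ¬ (openGraph ω).Reachable v y}) (forestEv V ∩ {ω | ¬ (openGraph ω).Reachable a b}) ≤
    fibreCount N u (forestEv V ∩ {ω | ¬ (openGraph ω).Reachable v a}) (forestEv V ∩ {ω | ¬ (openGraph ω).Reachable y b}) +
      fibreCount N u (forestEv V ∩ {ω | ¬ (openGraph ω).Reachable v b}) (forestEv V ∩ {ω | ¬ (openGraph ω).Reachable y a})

/-- **HUB⁺ on every finite vertex type** — the 4-terminal inequality behind the square-free adjacent forest Rayleigh node at degree-4 hubs,
with margin.  CONJECTURE-SHAPED COUNTING STATEMENT, NOT asserted (evidence in the module docstring).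
[cite: SempleWelsh2008, Conj. 1.1 (p. 2); Thm. 4.2 (p. 11)] -/
@[conjecture] def HubFourPlusPos : Prop := ∀ n : ℕ, HubFourPlusOn (Fin n)

/-- **HUB⁺ ⇒ the square-free adjacent forest Rayleigh inequality WITH MARGIN at every degree-4 hub**: on the split fibre
`(M ∪ {e,f}, u₀)`, if the pairs of `M ∪ u₀` at `o` are exactly the free pairs `oa, ob` (`o, v, y, a, b` distinct) then
`#(Fo ∩ {e,f ∈ ω}, Fo) + 2·E_vy ≤ #(Fo ∩ {e ∈ ω}, Fo ∩ {f ∈ ω})`, `E_vy` counted on the rest `(M ∖ {oa,ob}, u₀)`.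
[cite: SempleWelsh2008, Conj. 1.1 (p. 2)] [cite: CibulkaHladkyLaCroixWagner2008, Thm. 1 (p. 2)] [cite: Linusson2011, Prop. 2.6] -/
theorem adjForestNoSq_fibre_margin_of_hubFourPlusOn (hH : HubFourPlusOn V) {M u₀ : BondConfig V} (hd : Disjoint u₀ M) {o v y a b : V}
    (hov : o ≠ v) (hoy : o ≠ y) (hoa : o ≠ a) (hob : o ≠ b) (hvy : v ≠ y) (hva : v ≠ a) (hvb : v ≠ b) (hya : y ≠ a) (hyb : y ≠ b)
    (hab : a ≠ b) (heM : s(o, v) ∉ M) (hfM : s(o, y) ∉ M) (heu : s(o, v) ∉ u₀) (hfu : s(o, y) ∉ u₀)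
    (hgM : s(o, a) ∈ M) (hhM : s(o, b) ∈ M) (hdeg : ∀ p ∈ M ∪ u₀, o ∈ p → p = s(o, a) ∨ p = s(o, b)) :
    fibreCount (insert s(o, y) (insert s(o, v) M)) u₀ (forestEv V ∩ {ω | s(o, v) ∈ ω ∧ s(o, y) ∈ ω}) (forestEv V) +
      2 * fibreCount (M \ {s(o, a), s(o, b)}) u₀
        (forestEv V ∩ {ω | (openGraph ω).Reachable v y ∧ ¬ (openGraph ω).Reachable v a ∧ ¬ (openGraph ω).Reachable v b ∧
          ¬ (openGraph ω).Reachable y a ∧ ¬ (openGraph ω).Reachable y b ∧ ¬ (openGraph ω).Reachable a b}) (forestEv V) ≤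
    fibreCount (insert s(o, y) (insert s(o, v) M)) u₀ (forestEv V ∩ {ω | s(o, v) ∈ ω}) (forestEv V ∩ {ω | s(o, y) ∈ ω}) :=
  have hgu : s(o, a) ∉ u₀ := fun h => hd.le_bot ⟨h, hgM⟩
  have hhu : s(o, b) ∉ u₀ := fun h => hd.le_bot ⟨h, hhM⟩
  adjForestNoSq_fibre_margin_of_hubFourPlus hov hoy hoa hob hvy hva hvb hya hyb hab heM hfM heu hfu hgM hhM hgu hhu hdeg
    (hH _ u₀ (hd.mono_right sdiff_subset) v y a b hvy hva hvb hya hyb hab)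

/-- **`HubFourPlusPos` ⇒ the margin form on every `Fin n`** (pointwise corollary for the conjecture-shaped node).
[cite: SempleWelsh2008, Conj. 1.1 (p. 2)] -/
theorem hubFourPlusOn_fin_of_pos (h : HubFourPlusPos) (n : ℕ) : HubFourPlusOn (Fin n) := h n

end FK
end Summit.CriticalPhenomena.PercolationContinuityZ3.Theorems

end
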